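import Mathlib
import Literature.Probability.RandomPlanarGeometry.StopAtThickening
import Literature.Probability.RandomPlanarGeometry.ChordalCurveFamilyProofs
import Summits.CriticalPhenomena.SAWScalingLimit.Theorems.SAWRestrictionRigidityAxiomsOfLimitMarkovTestFunctions
import HarnessLib

/-!
# The `markov` clause at a closed set from approximating closed sets, under tip continuity of the kernel

Crux `AxiomsOfLimit` (stmt-CriticalPhenomena-1370), line `registered` (= `split`), stub `stub_markovOfLimit`: Markov passage,
part 5 (lead c3). Theorems only.

The lattice passage (parts 2–4) delivers the tensor identity `∫ f(stopAt G γ) g(startFrom G γ) dP = ∫ f(stopAt G γ)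
(∫ g dQ(stopAt G γ)) dP` only at closed sets `G` which the limit curve a.s. does not GRAZE (joint convergence of the split
map needs a.s. continuity), e.g. at generic closed thickenings `F_n = cthickening (1/(n+1)) F` of a given closed `F`. This
file proves the extension step isolated by lead c2 (memo `Lines/split_markov_c2.md` §1(c)) WITHOUT martingales: if the
tensor identities hold at closed sets `F_n` whose stopped and final segments converge to those of `F` for every curve
class, and the kernel is TIP-CONTINUOUS along these pasts (`∫ g dQ(stopAt F_n γ) → ∫ g dQ(stopAt F γ)` for a.e. `γ`), then
the tensor identity — hence (part 1) the `markov` clause — holds at `F` (dominated convergence on both sides).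

* `Curve.tendsto_startFrom_cthickening'`, `CurveClass.tendsto_startFrom_cthickening'` — the FINAL segments after the
  first hitting of the closed thickenings converge to the final segment after the first hitting of `F`, for every curve
  (companion of the tree's `tendsto_stopAt_cthickening`; same engine `Curve.tendsto_dist_comp_affineClamp`);
* `tensor_identity_of_approx` — the extension step for an arbitrary approximating sequence of closed sets;
* `markov_clause_of_approx`, `markov_clause_of_cthickening` — the `markov` clause at `F` from the tensor identities at
  the `F_n` and tip continuity (for thickenings the convergence of the segments is automatic).

References: W. Werner, *Lectures on two-dimensional critical percolation* (2007), §3.2 (2); G. F. Lawler, O. Schramm,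
W. Werner, Acta Math. 187 (2001), §2 (stopping on thickenings); O. Kallenberg, *Foundations of Modern Probability* (2002),
Thm 6.3. All [folklore].
-/

noncomputable section

open MeasureTheory ProbabilityTheory Filter Topology Set Metric BoundedContinuousFunction
open scoped NNReal ENNReal unitInterval

namespace Summit.CriticalPhenomena.SAWScalingLimit.Theorems.AxiomsOfLimitMarkov

open Literature.Probability.RandomPlanarGeometry

/-! ### Final segments after hitting the closed thickenings -/

/-- **`startFrom (cthickening (1/(n+1)) F) γ → startFrom F γ`** for closed `F` and every parametrised curve (the hitting
parameters increase to `hitParam F γ`, tree `Curve.tendsto_hitParam_cthickening`; the tails `γ ∘ affineClamp t (1 - t)`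
depend uniformly continuously on `t`, tree `Curve.tendsto_dist_comp_affineClamp`). [folklore] -/
theorem Curve.tendsto_startFrom_cthickening' {E : Type*} [MetricSpace E] {F : Set E} (hF : IsClosed F)
    (γ : Curve E) :
    Tendsto (fun n : ℕ => γ.startFrom (cthickening (1 / ((n : ℝ) + 1)) F)) atTop (𝓝 (γ.startFrom F)) := by
  have hlim := Curve.tendsto_hitParam_cthickening hF γ
  have hlimI : Tendsto (fun n : ℕ =>
      (⟨γ.hitParam (cthickening (1 / ((n : ℝ) + 1)) F), γ.hitParam_mem_Icc _⟩ : I)) atTop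
      (𝓝 ⟨γ.hitParam F, γ.hitParam_mem_Icc F⟩) := by
    rw [tendsto_subtype_rng]; exact hlim
  have h := Curve.tendsto_dist_comp_affineClamp γ hlimI (fun u => (u : ℝ)) (fun u => 1 - (u : ℝ))
    (fun u v => le_rfl) (fun u v => by rw [show (1 - (u : ℝ)) - (1 - v) = -((u : ℝ) - v) by ring, abs_neg])
  rw [tendsto_iff_dist_tendsto_zero]
  refine h.congr fun n => ?_
  rw [dist_comm]
  rfl

/-- **`startFrom (cthickening (1/(n+1)) F) c → startFrom F c`** for every curve class and closed `F` (through the chosen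
representative; `mk` is continuous). [folklore] -/
theorem CurveClass.tendsto_startFrom_cthickening' {E : Type*} [MetricSpace E] {F : Set E} (hF : IsClosed F)
    (c : CurveClass E) :
    Tendsto (fun n : ℕ => CurveClass.startFrom (cthickening (1 / ((n : ℝ) + 1)) F) c) atTop
      (𝓝 (CurveClass.startFrom F c)) :=
  (CurveClass.continuous_mk.tendsto _).comp (Curve.tendsto_startFrom_cthickening' hF c.out)

/-! ### The extension step -/

section Approx

variable (μ : Measure (CurveClass ℂ)) [IsFiniteMeasure μ] (κ : Kernel (CurveClass ℂ) (CurveClass ℂ))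
  [IsFiniteKernel κ]

/-- **The tensor identity passes from approximating closed sets to their limit under tip continuity.** Let `Fs n`, `F` be
sets with `stopAt (Fs n) γ → stopAt F γ` and `startFrom (Fs n) γ → startFrom F γ` for `μ`-a.e. `γ`, let `κ` be a finite
kernel which is tip-continuous along these pasts for a.e. `γ` (`∫ g dκ(stopAt (Fs n) γ) → ∫ g dκ(stopAt F γ)` for every
bounded continuous `g`), and suppose the tensor identities hold at every `Fs n`. Then the tensor identity holds at `F`.
[folklore] -/
theorem tensor_identity_of_approx {Fs : ℕ → Set ℂ} {F : Set ℂ}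
    (hstop : ∀ᵐ γ ∂μ, Tendsto (fun n => γ.stopAt (Fs n)) atTop (𝓝 (γ.stopAt F)))
    (hstart : ∀ᵐ γ ∂μ, Tendsto (fun n => γ.startFrom (Fs n)) atTop (𝓝 (γ.startFrom F)))
    (hmeas : ∀ n, Measurable (CurveClass.stopAt (Fs n) : CurveClass ℂ → CurveClass ℂ) ∧
      Measurable (CurveClass.startFrom (Fs n) : CurveClass ℂ → CurveClass ℂ))
    (hTC : ∀ g : CurveClass ℂ →ᵇ ℝ, ∀ᵐ γ ∂μ,
      Tendsto (fun n => ∫ η, g η ∂(κ (γ.stopAt (Fs n)))) atTop (𝓝 (∫ η, g η ∂(κ (γ.stopAt F)))))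
    (hn : ∀ n (f g : CurveClass ℂ →ᵇ ℝ),
      ∫ γ, f (γ.stopAt (Fs n)) * g (γ.startFrom (Fs n)) ∂μ =
        ∫ γ, f (γ.stopAt (Fs n)) * (∫ η, g η ∂(κ (γ.stopAt (Fs n)))) ∂μ)
    (f g : CurveClass ℂ →ᵇ ℝ) :
    ∫ γ, f (γ.stopAt F) * g (γ.startFrom F) ∂μ = ∫ γ, f (γ.stopAt F) * (∫ η, g η ∂(κ (γ.stopAt F))) ∂μ := by
  -- uniform bounds
  have hbd_int : ∀ p : CurveClass ℂ, |∫ η, g η ∂(κ p)| ≤ ‖g‖ * κ.bound.toReal := by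
    intro p
    calc |∫ η, g η ∂(κ p)| ≤ ∫ η, |g η| ∂(κ p) := abs_integral_le_integral_abs
      _ ≤ ∫ _, ‖g‖ ∂(κ p) := by
          refine integral_mono_of_nonneg (Eventually.of_forall fun b => abs_nonneg _) (integrable_const _)
            (Eventually.of_forall fun b => ?_)
          show |g b| ≤ ‖g‖
          rw [← Real.norm_eq_abs]; exact g.norm_coe_le_norm b
      _ = ‖g‖ * (κ p).real univ := by rw [integral_const, smul_eq_mul, mul_comm]
      _ ≤ ‖g‖ * κ.bound.toReal := by
          refine mul_le_mul_of_nonneg_left ?_ (norm_nonneg _)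
          exact ENNReal.toReal_mono κ.bound_ne_top (κ.measure_le_bound p univ)
  have hmeas_int : Measurable fun p : CurveClass ℂ => ∫ η, g η ∂(κ p) :=
    (g.continuous.stronglyMeasurable.integral_kernel (κ := κ)).measurable
  -- left-hand sides converge (dominated convergence)
  have hL : Tendsto (fun n => ∫ γ, f (γ.stopAt (Fs n)) * g (γ.startFrom (Fs n)) ∂μ) atTop
      (𝓝 (∫ γ, f (γ.stopAt F) * g (γ.startFrom F) ∂μ)) := by
    refine tendsto_integral_of_dominated_convergence (fun _ => ‖f‖ * ‖g‖) (fun n => ?_) (integrable_const _)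
      (fun n => Eventually.of_forall fun γ => ?_) ?_
    · exact ((f.continuous.measurable.comp (hmeas n).1).mul
        (g.continuous.measurable.comp (hmeas n).2)).aestronglyMeasurable
    · rw [norm_mul]
      exact mul_le_mul (f.norm_coe_le_norm _) (g.norm_coe_le_norm _) (norm_nonneg _) (norm_nonneg _)
    · filter_upwards [hstop, hstart] with γ h1 h2
      exact ((f.continuous.tendsto _).comp h1).mul ((g.continuous.tendsto _).comp h2)
  -- right-hand sides converge (dominated convergence + tip continuity)
  have hR : Tendsto (fun n => ∫ γ, f (γ.stopAt (Fs n)) * (∫ η, g η ∂(κ (γ.stopAt (Fs n)))) ∂μ) atTop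
      (𝓝 (∫ γ, f (γ.stopAt F) * (∫ η, g η ∂(κ (γ.stopAt F))) ∂μ)) := by
    refine tendsto_integral_of_dominated_convergence (fun _ => ‖f‖ * (‖g‖ * κ.bound.toReal)) (fun n => ?_)
      (integrable_const _) (fun n => Eventually.of_forall fun γ => ?_) ?_
    · exact ((f.continuous.measurable.comp (hmeas n).1).mul (hmeas_int.comp (hmeas n).1)).aestronglyMeasurable
    · rw [norm_mul, Real.norm_eq_abs (∫ η, g η ∂(κ _))]
      exact mul_le_mul (f.norm_coe_le_norm _) (hbd_int _) (abs_nonneg _) (norm_nonneg _)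
    · filter_upwards [hstop, hTC g] with γ h1 h2
      exact ((f.continuous.tendsto _).comp h1).mul h2
  exact tendsto_nhds_unique (hL.congr fun n => hn n f g) hR

/-- **The `markov` clause at `F` from approximating closed sets and tip continuity** (`tensor_identity_of_approx` +
part 1 `markov_clause_of_forall_integral`). [folklore] -/
theorem markov_clause_of_approx {Fs : ℕ → Set ℂ} (hFs : ∀ n, IsClosed (Fs n)) {F : Set ℂ} (hF : IsClosed F)
    (hstop : ∀ᵐ γ ∂μ, Tendsto (fun n => γ.stopAt (Fs n)) atTop (𝓝 (γ.stopAt F)))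
    (hstart : ∀ᵐ γ ∂μ, Tendsto (fun n => γ.startFrom (Fs n)) atTop (𝓝 (γ.startFrom F)))
    (hTC : ∀ g : CurveClass ℂ →ᵇ ℝ, ∀ᵐ γ ∂μ,
      Tendsto (fun n => ∫ η, g η ∂(κ (γ.stopAt (Fs n)))) atTop (𝓝 (∫ η, g η ∂(κ (γ.stopAt F)))))
    (hn : ∀ n (f g : CurveClass ℂ →ᵇ ℝ),
      ∫ γ, f (γ.stopAt (Fs n)) * g (γ.startFrom (Fs n)) ∂μ =
        ∫ γ, f (γ.stopAt (Fs n)) * (∫ η, g η ∂(κ (γ.stopAt (Fs n)))) ∂μ)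
    {S T : Set (CurveClass ℂ)} (hS : MeasurableSet S) (hT : MeasurableSet T) :
    μ (CurveClass.stopAt F ⁻¹' S ∩ CurveClass.startFrom F ⁻¹' T) =
      ∫⁻ γ in CurveClass.stopAt F ⁻¹' S, κ (γ.stopAt F) T ∂μ :=
  markov_clause_of_forall_integral μ hF κ
    (tensor_identity_of_approx μ κ hstop hstart
      (fun n => ⟨CurveClass.measurable_stopAt (hFs n), CurveClass.measurable_startFrom (hFs n)⟩) hTC hn) hS hT

/-- **The `markov` clause at a closed `F` from its closed thickenings and tip continuity.** If the tensor identities hold at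
every `F_n = cthickening (1/(n+1)) F` and `∫ g dκ(stopAt F_n γ) → ∫ g dκ(stopAt F γ)` for `μ`-a.e. `γ` and every bounded
continuous `g`, then the `markov` clause holds at `F` (the segments converge for EVERY curve class: tree
`CurveClass.tendsto_stopAt_cthickening` and `CurveClass.tendsto_startFrom_cthickening'`). [folklore] -/
theorem markov_clause_of_cthickening {F : Set ℂ} (hF : IsClosed F)
    (hTC : ∀ g : CurveClass ℂ →ᵇ ℝ, ∀ᵐ γ ∂μ,
      Tendsto (fun n : ℕ => ∫ η, g η ∂(κ (γ.stopAt (cthickening (1 / ((n : ℝ) + 1)) F)))) atTop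
        (𝓝 (∫ η, g η ∂(κ (γ.stopAt F)))))
    (hn : ∀ (n : ℕ) (f g : CurveClass ℂ →ᵇ ℝ),
      ∫ γ, f (γ.stopAt (cthickening (1 / ((n : ℝ) + 1)) F)) * g (γ.startFrom (cthickening (1 / ((n : ℝ) + 1)) F)) ∂μ =
        ∫ γ, f (γ.stopAt (cthickening (1 / ((n : ℝ) + 1)) F)) *
          (∫ η, g η ∂(κ (γ.stopAt (cthickening (1 / ((n : ℝ) + 1)) F)))) ∂μ)
    {S T : Set (CurveClass ℂ)} (hS : MeasurableSet S) (hT : MeasurableSet T) :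
    μ (CurveClass.stopAt F ⁻¹' S ∩ CurveClass.startFrom F ⁻¹' T) =
      ∫⁻ γ in CurveClass.stopAt F ⁻¹' S, κ (γ.stopAt F) T ∂μ :=
  markov_clause_of_approx μ κ (fun _ => isClosed_cthickening) hF
    (Eventually.of_forall fun γ => CurveClass.tendsto_stopAt_cthickening hF γ)
    (Eventually.of_forall fun γ => CurveClass.tendsto_startFrom_cthickening' hF γ) hTC hn hS hT


/-! ### Registered sub-goal of crux stmt-CriticalPhenomena-1370 (line `registered`, stub `stub_markovOfLimit`) -/

/-- **Registered sub-goal `stub_markovClauseOfThickening`** (crux stmt-CriticalPhenomena-1370, Markov passage, part 5):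
`markov_clause_of_cthickening` with all binders explicit, notation-free: the `markov` clause at a closed `F` from the tensor
identities at its closed thickenings and tip continuity of the kernel. [folklore] -/
theorem stub_markovClauseOfThickening :
    ∀ (μ : MeasureTheory.Measure (Literature.Probability.RandomPlanarGeometry.CurveClass ℂ)) [MeasureTheory.IsFiniteMeasure μ] (κ : ProbabilityTheory.Kernel (Literature.Probability.RandomPlanarGeometry.CurveClass ℂ) (Literature.Probability.RandomPlanarGeometry.CurveClass ℂ)) [ProbabilityTheory.IsFiniteKernel κ] (F : Set ℂ), IsClosed F → (∀ g : BoundedContinuousFunction (Literature.Probability.RandomPlanarGeometry.CurveClass ℂ) ℝ, Filter.Eventually (fun γ => Filter.Tendsto (fun n : ℕ => MeasureTheory.integral (κ (γ.stopAt (Metric.cthickening (1 / ((n : ℝ) + 1)) F))) (fun η => g η)) Filter.atTop (nhds (MeasureTheory.integral (κ (γ.stopAt F)) (fun η => g η)))) (MeasureTheory.ae μ)) → (∀ (n : ℕ) (f g : BoundedContinuousFunction (Literature.Probability.RandomPlanarGeometry.CurveClass ℂ) ℝ), MeasureTheory.integral μ (fun γ => f (γ.stopAt (Metric.cthickening (1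 / ((n : ℝ) + 1)) F)) * g (γ.startFrom (Metric.cthickening (1 / ((n : ℝ) + 1)) F))) = MeasureTheory.integral μ (fun γ => f (γ.stopAt (Metric.cthickening (1 / ((n : ℝ) + 1)) F)) * MeasureTheory.integral (κ (γ.stopAt (Metric.cthickening (1 / ((n : ℝ) + 1)) F))) (fun η => g η))) → ∀ S T : Set (Literature.Probability.RandomPlanarGeometry.CurveClass ℂ), MeasurableSet S → MeasurableSet T → μ (Literature.Probability.RandomPlanarGeometry.CurveClass.stopAt F ⁻¹' S ∩ Literature.Probability.RandomPlanarGeometry.CurveClass.startFrom F ⁻¹' T) = MeasureTheory.lintegral (μ.restrict (Literature.Probability.RandomPlanarGeometry.CurveClass.stopAt F ⁻¹' S)) (fun γ => κ (γ.stopAt F) T) :=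
  fun μ _ κ _ _ hF hTC hn _ _ hS hT => markov_clause_of_cthickening μ κ hF hTC hn hS hT

end Approx

end Summit.CriticalPhenomena.SAWScalingLimit.Theorems.AxiomsOfLimitMarkov

end
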